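import Summits.HodgeConjecture.HodgeConjecture.Theorems.F0LD2ThetaRealisesOfMultiplicityOne
import Summits.HodgeConjecture.HodgeConjecture.Theorems.F0LD2ThetaMultiplicityOneOfRealises
import HarnessLib

-- As in the lineage (★ `ThetaLiftFromLineRealises`): statements over the theta-kernel datum elaborate to very large types; elaborate sequentially.
set_option Elab.async false

/-!
# Crux `HLiu418`, LD lines — (M1θ) «MULTIPLICITY ONE OF THE THETA REPRESENTATION `Θ(a, ξ)` IN `L²([U(H)])`» AS A NAMED PREDICATE, and the named
# equivalence «(B6) `ThetaLiftFromLineRealises` ⟺ (M1θ) `ThetaMultiplicityOne`, given (I′) `ThetaLiftFromLineIrreducible`»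

Cell hodgecm-mathlib (D-0151), FLOOR 0; crux item `HLiu418` = stmt-HodgeConjecture-24832; LD leaves `Cruxes/HLiu418/Lines/F0_P6LD_StubS1FactsThetaRoad.lean` ∕
`…StubS1bFactsOrganRoad.lean`, printed letter stub `stub_letter_B6`.  Seat LD2-p01 (g4), PLATE «Q-PREP» PART 1 (LD2-plan (g3) 2026-09-02T11:50:51Z; LD1-plan (g2)
RULING Q 11:47:21Z (q1)–(q3)).  ONE predicate `def ThetaMultiplicityOne … : Prop` (body = the `hM1` binder of ★ p851319
`F0LD2ThetaRealisesOfMultiplicityOne.thetaLiftFromLineRealises_of_irreducible_of_multiplicityOne` VERBATIM; binder list = ★ `Liu2021.ThetaLiftFromLineRealises`'s, same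
explicitness, so that a leaf reads `ThetaMultiplicityOne L 2 H e₁ dV hdV hdV0 ιA μ lam hlam a' ξ` as the positional twin of the (B6) ∕ (I′) conclusions) + its `Iff.rfl`
unfolding + three theorems re-exporting ★ p851319 §2, ★ p851320 §2 and their conjunction as an `iff`.  No instance, no notation, no `sorry`; `--supports
stmt-HodgeConjecture-24832`.  HC_CM is proved only modulo the 7 printed citations (2 remaining: hLiu418 = stmt-HodgeConjecture-24832, h413 = stmt-HodgeConjecture-24833)
until rung 0 closes; NOTHING printed is discharged here and NO row is booked by this file: (M1θ) is a CANDIDATE re-wording of the printed letter (B6) = books row #185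
(OPTION Q rides the leaves' ED. 10 iff LD1-plan's (q1) costume box, (q2) lit1 locator and (q3) count check hold; else #185 stays (B6) and this file is ★ capital).

THE PREDICATE (M1θ) `ThetaMultiplicityOne L N H e₁ dV hdV hdV0 ιA μA μ hμ a ξ`: for EVERY closed `R`-invariant subspace `Q ⊆ L²([U(H)], μA)` whose carrier is the closure of
the span of ALL `(a, ξ)`-theta classes `[x ↦ Θ̃_Ψ(ξ)(ιA x)]` (all majorant witnesses, finite invariant measures on `[U(⟨a⟩)]`, Schwartz–Bruhat `Ψ`), EVERY discrete
automorphic representation `P` (irreducible closed invariant subspace, ★ `DiscreteAutomorphicRep`) UNITARILY EQUIVALENT to `Q` IS `Q` — the unitary isomorphism class of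
the theta representation `Θ(a, ξ)` occurs in `L²([U(H)])` with multiplicity exactly one (★ `ContRepresentation.HasMultiplicityOne` restricted to one class; vacuous when
the span is `0`).  GLOBAL statement, quantified over ALL discrete `P` in the class — NOT instantiated at a Hodge type or at one realisation (LD1-plan (q1)).
PRINT: for the compact unitary group `U(H)` in two variables over `L⁺` this is the multiplicity-one half of the endoscopic (`ρ(θ)`-) packet structure of `U(2)`
[Rogawski1990, §11.1 Prop. 11.1.1 (a), §11.2 Prop. 11.2.1 (a), Thm. 11.5.1 (c); LabesseLanglands1979 for the `ρ(θ)`; Harris1993 Thm. 2.6.3 for the inner form], and it is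
EQUIVALENT (given (I′)) to [Liu2021, Cor. B.6 (1) second clause] = [Wu2013, Thm. 5.1] as typed (B6) — the equivalence is the content of this file.

* `ThetaMultiplicityOne`, `thetaMultiplicityOne_iff` (`Iff.rfl`).
* `thetaLiftFromLineRealises_of_irreducible_of_thetaMultiplicityOne` — (I′) → (M1θ) → (B6), := ★ p851319 (unitary Schur dichotomy), under the letters' scaled
  frame `t ht g hg`, the pinned transport `hιA` and compact `[U(H)]` (needed to know the theta span is a closed invariant subspace, ★ `exists_closedSubrep_thetaSpan`).
* `thetaMultiplicityOne_of_realises_of_irreducible` — (B6) → (I′) → (M1θ), := ★ p851320 (isoclinic copy); no frame hypotheses.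
* `thetaLiftFromLineRealises_iff_thetaMultiplicityOne` — under (I′) and the frame: (B6) ↔ (M1θ).

References: [Liu2021] App. B Cor. B.6 (1), (3) (p. 99 = arXiv p. 45).  [Wu2013] Thm. 5.1.  [Rogawski1990] §11.  [DeitmarEchterhoff2014] Cor. 6.1.9.  [Dixmier1977] §5.4.
-/

set_option autoImplicit false
-- the mandated namespace has the single-problem summit's repeated segment (`HodgeConjecture.HodgeConjecture`)
set_option linter.dupNamespace false

noncomputable section

open NumberField MeasureTheory IsDedekindDomain
open scoped Matrix ComplexOrder ENNReal
open Literature.NumberTheory.Automorphic Literature.NumberTheory.Automorphic.UnitaryGroup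
open Literature.NumberTheory.Automorphic.UnitaryGroup.CotangentForms
open Literature.NumberTheory.Automorphic.IdeleClassGroup
open Literature.NumberTheory.Automorphic.Liu2021
open Literature.NumberTheory.Automorphic.Liu2021.Def411WeilCarriers
open Literature.NumberTheory.Automorphic.Liu2021.Def411WeilCarriersDoubling
open Literature.NumberTheory.GelbartRogawski1991 Literature.NumberTheory.GelbartRogawski1991.UnitaryDualPair
open Literature.NumberTheory.Weil1964
open Literature.RepresentationTheory.Liu2021
open Literature.RepresentationTheory.CompactGroups

namespace Summit.HodgeConjecture.HodgeConjecture.Cruxes.HLiu418.F0LD2ThetaMultiplicityOne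

variable (L : Type) [Field L] [NumberField L] [IsCMField L] (N : ℕ) (H : Matrix (Fin N) (Fin N) L)
  {n' : ℕ} (e₁ : Fin N × Fin 1 ≃ Fin n') (dV : Fin N → L) (hdV : ∀ i, IsCMField.complexConj L (dV i) = dV i)
  (hdV0 : ∀ i, dV i ≠ 0)
  (ιA : (adelicGroupData (↥(maximalRealSubfield L)) L (IsCMField.complexConj L) N H).Adelic →* ↥(UnitaryGroup.adelic (↥(maximalRealSubfield L)) L (IsCMField.complexConj L) N (Matrix.diagonal dV)))
  [CompactSpace (↥(UnitaryGroup.adelic (↥(maximalRealSubfield L)) L (IsCMField.complexConj L) N (Matrix.diagonal dV)) ⧸ (UnitaryGroup.toAdelic (↥(maximalRealSubfield L)) L (IsCMField.complexConj L) N (Matrix.diagonal dV)).range)]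
  (μA : Measure (adelicGroupData (↥(maximalRealSubfield L)) L (IsCMField.complexConj L) N H).automorphicQuotient) [(adelicGroupData (↥(maximalRealSubfield L)) L (IsCMField.complexConj L) N H).IsAutomorphicMeasure μA]
  (μ : Literature.NumberTheory.Automorphic.IdeleClassGroup L →ₜ* Circle) (hμ : IsConjugateSymplectic L μ) (a : (↥(maximalRealSubfield L))ˣ)
  (ξ : haveI := normal_range_toAdelic_JW L a
    PontryaginDual (↥(UnitaryGroup.adelic (↥(maximalRealSubfield L)) L (IsCMField.complexConj L) 1 (JW (↥(maximalRealSubfield L)) L a)) ⧸ (UnitaryGroup.toAdelic (↥(maximalRealSubfield L)) L (IsCMField.complexConj L) 1 (JW (↥(maximalRealSubfield L)) L a)).range))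

/-- **(M1θ) MULTIPLICITY ONE OF THE THETA REPRESENTATION `Θ(a, ξ)` IN `L²([U(H)])`** (as a predicate of the theta-road data, binders = ★
`Liu2021.ThetaLiftFromLineRealises`'s): every discrete automorphic `P` unitarily equivalent to a closed invariant subspace `Q` whose carrier is the closed
`(a, ξ)`-theta span IS `Q`.  Body = the `hM1` binder of ★ `F0LD2ThetaRealisesOfMultiplicityOne.thetaLiftFromLineRealises_of_irreducible_of_multiplicityOne` verbatim.
An in-house PREDICATE of the line (organ-grade definition; asserted nowhere in this file; its closure over the curve frames is the candidate ED. 10 letter stub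
`stub_letter_multOneTheta`).  Printed sources (Rogawski1990, §11.1 Prop. 11.1.1 (a), §11.2 Prop. 11.2.1 (a), Thm. 11.5.1 (c)) (Liu2021, App. B Cor. B.6 (1), (3), p. 99)
(Wu2013, Thm. 5.1) (Dixmier1977, §5.4: multiplicity). -/
def ThetaMultiplicityOne : Prop :=
  letI : MeasurableSpace (↥(UnitaryGroup.adelic (↥(maximalRealSubfield L)) L (IsCMField.complexConj L) 1 (JW (↥(maximalRealSubfield L)) L a)) ⧸ (UnitaryGroup.toAdelic (↥(maximalRealSubfield L)) L (IsCMField.complexConj L) 1 (JW (↥(maximalRealSubfield L)) L a)).range) := borel _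
  haveI := normal_range_toAdelic_JW L a
  ∀ (Q : ContRepresentation.ClosedSubrep ((adelicGroupData (↥(maximalRealSubfield L)) L (IsCMField.complexConj L) N H).rightRegular μA)),
    (Q.toSubmodule : Set ((adelicGroupData (↥(maximalRealSubfield L)) L (IsCMField.complexConj L) N H).L2 μA)) = closure (Submodule.span ℂ
      {v : (adelicGroupData (↥(maximalRealSubfield L)) L (IsCMField.complexConj L) N H).L2 μA | ∃ (hρ : HasThetaMajorants fun
    (p : ↥(UnitaryGroup.adelic (↥(maximalRealSubfield L)) L (IsCMField.complexConj L) N (Matrix.diagonal dV)) × ↥(UnitaryGroup.adelic (↥(maximalRealSubfield L)) L (IsCMField.complexConj L) 1 (JW (↥(maximalRealSubfield L)) L a))) (Φ : piSchwartzBruhat (↥(maximalRealSubfield L)) (Fin n')) =>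
      pairRep (↥(maximalRealSubfield L)) L (IsCMField.complexConj L) N 1 e₁ (Matrix.diagonal dV) (JW (↥(maximalRealSubfield L)) L a)
        (chiSplittingLine L e₁ dV hdV hdV0 (toHeckeCharacter L μ) (isUnitary_toHeckeCharacter L μ)
          ((isOscillatorChar_toHeckeCharacter_iff μ).mpr hμ) (TW (↥(maximalRealSubfield L)) a)
          (isUnit_det_TW (↥(maximalRealSubfield L)) a) (JW (↥(maximalRealSubfield L)) L a) (JW_eq (↥(maximalRealSubfield L)) L a))
        p Φ)
      (μW : Measure (↥(UnitaryGroup.adelic (↥(maximalRealSubfield L)) L (IsCMField.complexConj L) 1 (JW (↥(maximalRealSubfield L)) L a)) ⧸ (UnitaryGroup.toAdelic (↥(maximalRealSubfield L)) L (IsCMField.complexConj L) 1 (JW (↥(maximalRealSubfield L)) L a)).range)) (_ : IsFiniteMeasure μW)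
      (_ : SMulInvariantMeasure ↥(UnitaryGroup.adelic (↥(maximalRealSubfield L)) L (IsCMField.complexConj L) 1 (JW (↥(maximalRealSubfield L)) L a)) (↥(UnitaryGroup.adelic (↥(maximalRealSubfield L)) L (IsCMField.complexConj L) 1 (JW (↥(maximalRealSubfield L)) L a)) ⧸ (UnitaryGroup.toAdelic (↥(maximalRealSubfield L)) L (IsCMField.complexConj L) 1 (JW (↥(maximalRealSubfield L)) L a)).range) μW)
      (Ψ : piSchwartzBruhat (↥(maximalRealSubfield L)) (Fin n'))
      (hθ : MemLp (toQuotFun (adelicGroupData (↥(maximalRealSubfield L)) L (IsCMField.complexConj L) N H) fun x =>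
        (lineThetaKernelDatum L N e₁ dV hdV hdV0 μ hμ a hρ).thetaLiftFun μW Ψ (charCM ξ) (ιA x)) 2 μA),
      v = MemLp.toLp _ hθ} : Set ((adelicGroupData (↥(maximalRealSubfield L)) L (IsCMField.complexConj L) N H).L2 μA)) →
    ∀ P : DiscreteAutomorphicRep (adelicGroupData (↥(maximalRealSubfield L)) L (IsCMField.complexConj L) N H) μA,
      ContRepresentation.AreUnitarilyEquivalent P.space.toContRep Q.toContRep → P.space = Q

/-- Unfolding of `ThetaMultiplicityOne` (`Iff.rfl`). [cite: Rogawski1990, §11.1] [cite: Dixmier1977, §5.4] -/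
theorem thetaMultiplicityOne_iff :
    ThetaMultiplicityOne L N H e₁ dV hdV hdV0 ιA μA μ hμ a ξ ↔
      (letI : MeasurableSpace (↥(UnitaryGroup.adelic (↥(maximalRealSubfield L)) L (IsCMField.complexConj L) 1 (JW (↥(maximalRealSubfield L)) L a)) ⧸ (UnitaryGroup.toAdelic (↥(maximalRealSubfield L)) L (IsCMField.complexConj L) 1 (JW (↥(maximalRealSubfield L)) L a)).range) := borel _
  haveI := normal_range_toAdelic_JW L a
  ∀ (Q : ContRepresentation.ClosedSubrep ((adelicGroupData (↥(maximalRealSubfield L)) L (IsCMField.complexConj L) N H).rightRegular μA)),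
    (Q.toSubmodule : Set ((adelicGroupData (↥(maximalRealSubfield L)) L (IsCMField.complexConj L) N H).L2 μA)) = closure (Submodule.span ℂ
      {v : (adelicGroupData (↥(maximalRealSubfield L)) L (IsCMField.complexConj L) N H).L2 μA | ∃ (hρ : HasThetaMajorants fun
    (p : ↥(UnitaryGroup.adelic (↥(maximalRealSubfield L)) L (IsCMField.complexConj L) N (Matrix.diagonal dV)) × ↥(UnitaryGroup.adelic (↥(maximalRealSubfield L)) L (IsCMField.complexConj L) 1 (JW (↥(maximalRealSubfield L)) L a))) (Φ : piSchwartzBruhat (↥(maximalRealSubfield L)) (Fin n')) =>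
      pairRep (↥(maximalRealSubfield L)) L (IsCMField.complexConj L) N 1 e₁ (Matrix.diagonal dV) (JW (↥(maximalRealSubfield L)) L a)
        (chiSplittingLine L e₁ dV hdV hdV0 (toHeckeCharacter L μ) (isUnitary_toHeckeCharacter L μ)
          ((isOscillatorChar_toHeckeCharacter_iff μ).mpr hμ) (TW (↥(maximalRealSubfield L)) a)
          (isUnit_det_TW (↥(maximalRealSubfield L)) a) (JW (↥(maximalRealSubfield L)) L a) (JW_eq (↥(maximalRealSubfield L)) L a))
        p Φ)
      (μW : Measure (↥(UnitaryGroup.adelic (↥(maximalRealSubfield L)) L (IsCMField.complexConj L) 1 (JW (↥(maximalRealSubfield L)) L a)) ⧸ (UnitaryGroup.toAdelic (↥(maximalRealSubfield L)) L (IsCMField.complexConj L) 1 (JW (↥(maximalRealSubfield L)) L a)).range)) (_ : IsFiniteMeasure μW)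
      (_ : SMulInvariantMeasure ↥(UnitaryGroup.adelic (↥(maximalRealSubfield L)) L (IsCMField.complexConj L) 1 (JW (↥(maximalRealSubfield L)) L a)) (↥(UnitaryGroup.adelic (↥(maximalRealSubfield L)) L (IsCMField.complexConj L) 1 (JW (↥(maximalRealSubfield L)) L a)) ⧸ (UnitaryGroup.toAdelic (↥(maximalRealSubfield L)) L (IsCMField.complexConj L) 1 (JW (↥(maximalRealSubfield L)) L a)).range) μW)
      (Ψ : piSchwartzBruhat (↥(maximalRealSubfield L)) (Fin n'))
      (hθ : MemLp (toQuotFun (adelicGroupData (↥(maximalRealSubfield L)) L (IsCMField.complexConj L) N H) fun x =>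
        (lineThetaKernelDatum L N e₁ dV hdV hdV0 μ hμ a hρ).thetaLiftFun μW Ψ (charCM ξ) (ιA x)) 2 μA),
      v = MemLp.toLp _ hθ} : Set ((adelicGroupData (↥(maximalRealSubfield L)) L (IsCMField.complexConj L) N H).L2 μA)) →
    ∀ P : DiscreteAutomorphicRep (adelicGroupData (↥(maximalRealSubfield L)) L (IsCMField.complexConj L) N H) μA,
      ContRepresentation.AreUnitarilyEquivalent P.space.toContRep Q.toContRep → P.space = Q) :=
  Iff.rfl

/-- **(I′) → (M1θ) → (B6)** under the letters' scaled frame `formCongr c g (t • H) = diag dV`, the pinned transport `↑(ιA k) = g_𝔸⁻¹ k g_𝔸` and compact `[U(H)]`: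
★ p851319 `F0LD2ThetaRealisesOfMultiplicityOne.thetaLiftFromLineRealises_of_irreducible_of_multiplicityOne` with the multiplicity hypothesis packaged as
`ThetaMultiplicityOne`. [cite: Liu2021, App. B Cor. B.6 (1), (3) (p. 99)] [cite: DeitmarEchterhoff2014, Cor. 6.1.9] [cite: Rogawski1990, §11.1] -/
theorem thetaLiftFromLineRealises_of_irreducible_of_thetaMultiplicityOne (t : L) (ht : t ≠ 0) (g : GL (Fin N) L)
    (hg : formCongr ((IsCMField.complexConj L : L ≃ₐ[(↥(maximalRealSubfield L))] L) : L →+* L) g (t • H) = Matrix.diagonal dV)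
    (hιA : ∀ k, ((ιA k : ↥(UnitaryGroup.adelic (↥(maximalRealSubfield L)) L (IsCMField.complexConj L) N (Matrix.diagonal dV))) : GL (Fin N) (AdeleRing (𝓞 L) L)) =
      (toAdeleGL L g)⁻¹ * adelicVal (↥(maximalRealSubfield L)) L (IsCMField.complexConj L) N H k * toAdeleGL L g)
    [CompactSpace (adelicGroupData (↥(maximalRealSubfield L)) L (IsCMField.complexConj L) N H).automorphicQuotient]
    (hIrr : ThetaLiftFromLineIrreducible L N H e₁ dV hdV hdV0 ιA μA μ hμ a ξ)
    (hM1 : ThetaMultiplicityOne L N H e₁ dV hdV hdV0 ιA μA μ hμ a ξ) :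
    ThetaLiftFromLineRealises L N H e₁ dV hdV hdV0 ιA μA μ hμ a ξ :=
  F0LD2ThetaRealisesOfMultiplicityOne.thetaLiftFromLineRealises_of_irreducible_of_multiplicityOne L N H e₁ dV hdV hdV0 t ht g hg ιA hιA
    (μA := μA) μ hμ a ξ hIrr hM1

/-- **(B6) → (I′) → (M1θ)** (no frame hypothesis): ★ p851320 `F0LD2ThetaMultiplicityOneOfRealises.multiplicityOne_of_thetaLiftFromLineRealises` (isoclinic
copy). [cite: Liu2021, App. B Cor. B.6 (1), (3) (p. 99)] [cite: Wu2013, Thm. 5.1] [cite: DeitmarEchterhoff2014, Cor. 6.1.9] -/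
theorem thetaMultiplicityOne_of_realises_of_irreducible
    (hReal : ThetaLiftFromLineRealises L N H e₁ dV hdV hdV0 ιA μA μ hμ a ξ)
    (hIrr : ThetaLiftFromLineIrreducible L N H e₁ dV hdV hdV0 ιA μA μ hμ a ξ) :
    ThetaMultiplicityOne L N H e₁ dV hdV hdV0 ιA μA μ hμ a ξ :=
  F0LD2ThetaMultiplicityOneOfRealises.multiplicityOne_of_thetaLiftFromLineRealises L N H e₁ dV hdV hdV0 ιA (μA := μA) μ hμ a ξ hReal hIrr

/-- **(B6) ⟺ (M1θ) GIVEN (I′)** (and the letters' frame, for the forward closed-span invariance): the printed realisation letter [Liu2021, Cor. B.6 (1)] = [Wu2013,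
Thm. 5.1] as typed IS multiplicity one of the theta representation `Θ(a, ξ)` in `L²([U(H)])`. [cite: Liu2021, App. B Cor. B.6 (1), (3) (p. 99)]
[cite: Wu2013, Thm. 5.1] [cite: Rogawski1990, §11.1] [cite: DeitmarEchterhoff2014, Cor. 6.1.9] -/
theorem thetaLiftFromLineRealises_iff_thetaMultiplicityOne (t : L) (ht : t ≠ 0) (g : GL (Fin N) L)
    (hg : formCongr ((IsCMField.complexConj L : L ≃ₐ[(↥(maximalRealSubfield L))] L) : L →+* L) g (t • H) = Matrix.diagonal dV)
    (hιA : ∀ k, ((ιA k : ↥(UnitaryGroup.adelic (↥(maximalRealSubfield L)) L (IsCMField.complexConj L) N (Matrix.diagonal dV))) : GL (Fin N) (AdeleRing (𝓞 L) L)) =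
      (toAdeleGL L g)⁻¹ * adelicVal (↥(maximalRealSubfield L)) L (IsCMField.complexConj L) N H k * toAdeleGL L g)
    [CompactSpace (adelicGroupData (↥(maximalRealSubfield L)) L (IsCMField.complexConj L) N H).automorphicQuotient]
    (hIrr : ThetaLiftFromLineIrreducible L N H e₁ dV hdV hdV0 ιA μA μ hμ a ξ) :
    ThetaLiftFromLineRealises L N H e₁ dV hdV hdV0 ιA μA μ hμ a ξ ↔ ThetaMultiplicityOne L N H e₁ dV hdV hdV0 ιA μA μ hμ a ξ :=
  ⟨fun hReal => thetaMultiplicityOne_of_realises_of_irreducible L N H e₁ dV hdV hdV0 ιA μA μ hμ a ξ hReal hIrr,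
    fun hM1 => thetaLiftFromLineRealises_of_irreducible_of_thetaMultiplicityOne L N H e₁ dV hdV hdV0 ιA μA μ hμ a ξ t ht g hg hιA hIrr hM1⟩

end Summit.HodgeConjecture.HodgeConjecture.Cruxes.HLiu418.F0LD2ThetaMultiplicityOne

end
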